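import Literature.AlgebraicGeometry.Motives.HodgeStructureOfOrientationSubHodgeStructures
import Literature.AlgebraicGeometry.Motives.HodgeStructureStrongCMIsotypic
import Literature.AlgebraicGeometry.Motives.HodgeTensorFactsHolds
import Literature.AlgebraicGeometry.Motives.ZarhinHodgeGroupAutC
import Literature.AlgebraicGeometry.Motives.MixedHodgeStructureStrictProofs
import Mathlib.NumberTheory.Cyclotomic.PrimitiveRoots

/-!
# A rational Hodge structure with a cyclotomic endomorphism whose eigenline type table is SEPARATED
# has `End_Hdg = ℚ[a]` (chapter «CYC-SEP», Level 1: abstract Hodge structures)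

Chapter «CYC-SEP» of cell hodge-nonav (planner p1 g30, memo `ROUTE-P1AC` ca0119db2de2209a, Sketch
`ROUTE-P1AC-Sketch.lean` sha16 52b6eebf40de0c37, `namespace HodgeNonAV.P1AC`, Level 1 :1160–1379), landed
as tree theorems (ask A35-a). Consumer: `Theorems/SeparatedCyclotomicSelfMapSquareHodge` (Level 2: squares of
surfaces with a separated cyclotomic self-map, `HodgeConjectureFor 4 (S ⊗ S)`).

**`coe_endAlg_mem_span_pow_of_separated`.** Let `H` be a `ℚ`-Hodge structure of weight `n` on `V`,
`dim V = φ(N)`, and `a ∈ End_Hdg(H)` whose complexification has an eigenbasis `ω_u` (`u ∈ (ℤ/N)ˣ`) with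
`a_ℂ ω_u = ζ^u ω_u` (`ζ` a primitive `N`-th root of unity), each `ω_u` of exact Hodge level `deg u`
(`ω_u ∈ F^{deg u} ∖ F^{deg u + 1}`). If the type table `deg` is SEPARATED — no unit `w ≠ 1` has
`deg (w u) = deg u` for all `u` — then `End_Hdg(H) = ℚ[a] = Σ_{k<N} ℚ a^k`.

PROOF. The field `K = ℚ(ζ_N)` acts on `H` through `η : ζ_N ↦ a` (`IsPrimitiveRoot.powerBasis`,
`PowerBasis.lift`; `Φ_N(a) = 0` is read off the eigenbasis, `eq_zero_of_baseChange_apply_eq_zero`), a STRONG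
CM action (`[ℚ(ζ_N):ℚ] = dim V`); the GGK orientation `Λ = A.orientation` of this action
[Green–Griffiths–Kerr §V.C] has `Λ.deg σ = deg u` for the embedding `σ : ζ_N ↦ ζ^u` (eigenline bookkeeping
`EndAction.iInf_eigenspace_le_piece` + the opposedness `F^p ∩ conj F^q = 0`, `p + q > n`). (SEP) says `Λ` is
PRIMITIVE in the `Aut(ℂ)`-form (Galois automorphisms of the cyclotomic field are `ζ_N ↦ ζ_N^w`, and
`φ ∘ σ_u = σ_{wu}` up to `Aut(ℂ)` by `ZarhinLie.exists_ringEquiv_complex_comp_eq`), so the tree's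
`isIrreducible_ofOrientation_of_primitive` + `EndAction.exists_hom_ofOrientation_bijective` +
`IsIrreducible.of_bijective` make `H` irreducible and `EndAction.range_ι_eq_endAlg` gives
`End_Hdg(H) = η(K) = ℚ[a]` (`= span{a^k : k < N}` by `Φ_N(a) = 0`).

Prover seat hodge-nonav-19716-p2 g0 (`--supports stmt-HodgeConjecture-19652`, helper). No named fact, no
definition, no sorry. Nothing here bears on the Hodge conjecture by itself.

References: Green–Griffiths–Kerr, *Mumford–Tate groups and domains* (2012) §V.C (i),(ii) p. 161;
Huybrechts, *Lectures on K3 surfaces* (2016) Ch. 3 Cor. 3.6, Thm. 3.7; Zarhin, *Hodge groups of K3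
surfaces*, J. reine angew. Math. 341 (1983) Thm. 1.5.1, 1.6; Shioda, *The Hodge conjecture for Fermat
varieties*, Math. Ann. 245 (1979) Thm. II.
-/

set_option linter.dupNamespace false

noncomputable section

namespace Summit.HodgeConjecture.HodgeConjecture.Theorems.SeparatedCyclotomicSelfMapSquareHodge

open scoped TensorProduct
open Literature.AlgebraicGeometry Literature.AlgebraicGeometry.Motives
open Literature.AlgebraicGeometry.Motives.HodgeStructure
open Polynomial

/-! ### CYC-SEP, Level 1 (abstract): a strong cyclotomic action with separated type table fills `End_Hdg` -/

section LevelOne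

universe u

variable {V : Type u} [AddCommGroup V] [Module ℚ V]

/-- Base change of a polynomial in an endomorphism: `(q(α))_ℂ = q(α_ℂ)`. [folklore] -/
theorem baseChange_aeval (α : Module.End ℚ V) (q : ℚ[X]) :
    (aeval α q).baseChange ℂ = aeval (α.baseChange ℂ) (q.map (algebraMap ℚ ℂ)) := by
  induction q using Polynomial.induction_on' with
  | add p q hp hq => rw [map_add, LinearMap.baseChange_add, hp, hq, Polynomial.map_add, map_add]
  | monomial n c =>
    rw [Polynomial.map_monomial, aeval_monomial, aeval_monomial, LinearMap.baseChange_mul, LinearMap.baseChange_pow,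
      Algebra.algebraMap_eq_smul_one, Algebra.algebraMap_eq_smul_one, LinearMap.baseChange_smul,
      LinearMap.baseChange_one, algebraMap_smul]

/-- The eigenvalues `ζ^u`, `u ∈ (ℤ/N)ˣ`, of a primitive `N`-th root of unity are pairwise distinct. [folklore] -/
theorem pow_val_injective {N : ℕ} [NeZero N] {ζ : ℂ} (hζ : IsPrimitiveRoot ζ N) :
    Function.Injective fun u : (ZMod N)ˣ ↦ ζ ^ (u : ZMod N).val := by
  intro u w h
  exact Units.ext (ZMod.val_injective N (hζ.pow_inj (ZMod.val_lt _) (ZMod.val_lt _) h))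

/-- A `ℚ`-endomorphism whose complexification kills a spanning family is zero (faithful flatness of `ℂ/ℚ`).
[folklore] -/
theorem eq_zero_of_baseChange_apply_eq_zero {ι : Type*} (ω : ι → ℂ ⊗[ℚ] V)
    (hspan : Submodule.span ℂ (Set.range ω) = ⊤) (P : Module.End ℚ V)
    (hP : ∀ i, P.baseChange ℂ (ω i) = 0) : P = 0 := by
  have hPC : P.baseChange ℂ = 0 := by
    refine LinearMap.ext_on_range hspan fun i ↦ ?_
    rw [hP, LinearMap.zero_apply]
  ext v
  have h1 : (1 : ℂ) ⊗ₜ[ℚ] P v = 0 := by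
    rw [← LinearMap.baseChange_tmul, hPC, LinearMap.zero_apply]
  have h2 : P v ∈ (⊥ : Submodule ℚ V) :=
    MixedHodgeStructure.mem_of_one_tmul_mem_baseChange ⊥ (by rw [Submodule.baseChange_bot, h1]; exact zero_mem _)
  rw [LinearMap.zero_apply]
  exact (Submodule.mem_bot ℚ).1 h2

/-- `ζ^{u.val}` for units: `ζ^{(w u).val} = ζ^{w.val · u.val}`. [folklore] -/
theorem pow_val_mul {N : ℕ} [NeZero N] {ζ : ℂ} (hζ : IsPrimitiveRoot ζ N) (w u : (ZMod N)ˣ) :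
    ζ ^ ((w * u : (ZMod N)ˣ) : ZMod N).val = (ζ ^ (w : ZMod N).val) ^ (u : ZMod N).val := by
  rw [← pow_mul, Units.val_mul, ZMod.val_mul]
  conv_rhs => rw [← Nat.mod_add_div ((w : ZMod N).val * (u : ZMod N).val) N]
  rw [pow_add, pow_mul, hζ.pow_eq_one, one_pow, mul_one]

/-- **CYC-SEP, abstract form.** Let `H` be a `ℚ`-Hodge structure of weight `n` on `V`, `dim V = φ(N)`, and `a ∈ End_Hdg(H)`
whose complexification has an eigenbasis `ω_u` (`u ∈ (ℤ/N)ˣ`) with `a_ℂ ω_u = ζ^u ω_u` (`ζ` a primitive `N`-th root of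
unity), each `ω_u` of exact Hodge level `deg u` (`ω_u ∈ F^{deg u} ∖ F^{deg u + 1}`). If the type table `deg` is SEPARATED —
no unit `w ≠ 1` has `deg (w u) = deg u` for all `u` — then `End_Hdg(H) = ℚ[a] = ⊕_{k<N} ℚ a^k`. PROOF: `ℚ(ζ_N)` acts on
`H` through `ζ_N ↦ a` (a STRONG CM action, `[ℚ(ζ_N):ℚ] = dim V`); its GGK orientation is `σ_u ↦ deg u`, which is primitive in
the `Aut(ℂ)`-form exactly when `deg` is separated; primitive ⇒ `H` irreducible ⇒ `End_Hdg(H) = η(ℚ(ζ_N))` (tree: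
`isIrreducible_ofOrientation_of_primitive`, `EndAction.range_ι_eq_endAlg`). [cite: GreenGriffithsKerr2012, §V.C (i),(ii) p. 161]
[cite: Huybrechts2016K3, Ch. 3 Cor. 3.6 and Thm. 3.7] -/
theorem coe_endAlg_mem_span_pow_of_separated [Module.Finite ℚ V] {n : ℤ} {H : HodgeStructure V n}
    (a : H.endAlg) {N : ℕ} (hN : 0 < N) {ζ : ℂ} (hζ : IsPrimitiveRoot ζ N)
    (deg : (ZMod N)ˣ → ℤ) (ω : (ZMod N)ˣ → ℂ ⊗[ℚ] V) (hω0 : ∀ u, ω u ≠ 0)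
    (hF : ∀ u, ω u ∈ H.F (deg u)) (hnF : ∀ u, ω u ∉ H.F (deg u + 1))
    (heig : ∀ u, ((a : Module.End ℚ V).baseChange ℂ) (ω u) = ζ ^ (u : ZMod N).val • ω u)
    (hrk : Module.finrank ℚ V = Nat.totient N)
    (hsep : ∀ w : (ZMod N)ˣ, (∀ u, deg (w * u) = deg u) → w = 1) (g : H.endAlg) :
    (g : Module.End ℚ V) ∈ Submodule.span ℚ (Set.range fun k : Fin N ↦ (a : Module.End ℚ V) ^ (k : ℕ)) := by
  haveI : NeZero N := ⟨hN.ne'⟩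
  haveI : HodgeTensorFacts.{u, u} := hodgeTensorFacts_holds.{u, u}
  set α : Module.End ℚ V := (a : Module.End ℚ V) with hαdef
  -- (A) the eigenbasis `ω`
  have hμ : Function.Injective fun u : (ZMod N)ˣ ↦ ζ ^ (u : ZMod N).val := pow_val_injective hζ
  have hev : ∀ u : (ZMod N)ˣ, Module.End.HasEigenvector (α.baseChange ℂ) (ζ ^ (u : ZMod N).val) (ω u) := fun u ↦
    ⟨Module.End.mem_eigenspace_iff.2 (heig u), hω0 u⟩
  have hli : LinearIndependent ℂ ω := Module.End.eigenvectors_linearIndependent' _ _ hμ ω hev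
  have hcard : Fintype.card (ZMod N)ˣ = Module.finrank ℂ (ℂ ⊗[ℚ] V) := by
    rw [ZMod.card_units_eq_totient, Module.finrank_baseChange, hrk]
  have hspan : Submodule.span ℂ (Set.range ω) = ⊤ := hli.span_eq_top_of_card_eq_finrank' hcard
  -- (B) `Φ_N(α) = 0`, hence `α^N = 1`
  have hΦ : aeval α (cyclotomic N ℚ) = 0 := by
    refine eq_zero_of_baseChange_apply_eq_zero ω hspan _ fun u ↦ ?_
    rw [baseChange_aeval, Module.End.aeval_apply_of_hasEigenvector (hev u), map_cyclotomic,
      ((hζ.pow_of_coprime _ (ZMod.val_coe_unit_coprime u)).isRoot_cyclotomic hN).eq_zero, zero_smul]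
  have hαN : α ^ N = 1 := by
    obtain ⟨q, hq⟩ := cyclotomic.dvd_X_pow_sub_one N ℚ
    have h := congrArg (aeval α) hq
    rw [map_mul, hΦ, zero_mul, map_sub, map_pow, aeval_X, map_one, sub_eq_zero] at h
    exact h
  have hpowmod : ∀ k : ℕ, α ^ k = α ^ (k % N) := fun k ↦ by
    conv_lhs => rw [← Nat.mod_add_div k N, pow_add, pow_mul, hαN, one_pow, mul_one]
  -- (C) the cyclotomic field `K = ℚ(ζ_N)` acting through `ζ_N ↦ α`
  let K := CyclotomicField N ℚ
  haveI hKc : IsCyclotomicExtension {N} ℚ K := CyclotomicField.isCyclotomicExtension N ℚ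
  haveI : NumberField K := IsCyclotomicExtension.numberField {N} ℚ K
  haveI : Countable K := Countable.of_equiv _ (Module.finBasis ℚ K).equivFun.toEquiv.symm
  set ζK : K := IsCyclotomicExtension.zeta N ℚ K with hζKdef
  have hζK : IsPrimitiveRoot ζK N := IsCyclotomicExtension.zeta_spec N ℚ K
  have hirrQ : Irreducible (cyclotomic N ℚ) := cyclotomic.irreducible_rat hN
  set pb : PowerBasis ℚ K := hζK.powerBasis ℚ with hpbdef
  have hpbgen : pb.gen = ζK := by rw [hpbdef, IsPrimitiveRoot.powerBasis_gen]
  have hminpoly : minpoly ℚ pb.gen = cyclotomic N ℚ := by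
    rw [hpbgen, ← hζK.minpoly_eq_cyclotomic_of_irreducible hirrQ]
  have hcyc_aeval : ∀ x : ℂ, aeval x (cyclotomic N ℚ) = (cyclotomic N ℂ).eval x := fun x ↦ by
    rw [aeval_def, eval₂_eq_eval_map, map_cyclotomic]
  have hy : aeval α (minpoly ℚ pb.gen) = 0 := by rw [hminpoly, hΦ]
  set η : K →ₐ[ℚ] Module.End ℚ V := pb.lift α hy with hηdef
  have hη_aeval : ∀ p : ℚ[X], η (aeval ζK p) = aeval α p := fun p ↦ by
    rw [← hpbgen]; exact pb.lift_aeval α hy p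
  have hηmem : ∀ e, η e ∈ H.endAlg := by
    intro e
    obtain ⟨p, hp⟩ := pb.exists_eq_aeval' e
    rw [hp, hpbgen, hη_aeval]
    exact Algebra.adjoin_le (Set.singleton_subset_iff.2 a.2) (aeval_mem_adjoin_singleton ℚ α)
  let A : EndAction H K := ⟨η, fun e p ↦ (mem_endAlg_iff H _).1 (hηmem e) p⟩
  have hAι : A.ι = η := rfl
  have hS' : Module.finrank ℚ K = Module.finrank ℚ V := by
    rw [IsCyclotomicExtension.finrank K hirrQ, hrk]
  -- the value of an embedding on polynomials in `ζ_N`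
  have hσ_aeval : ∀ (σ : K →+* ℂ) (p : ℚ[X]), σ (aeval ζK p) = (p.map (algebraMap ℚ ℂ)).eval (σ ζK) := by
    intro σ p
    rw [Polynomial.eval_map, aeval_def, Polynomial.hom_eval₂]
    congr 1
    exact Subsingleton.elim _ _
  -- (D) every embedding is `ζ_N ↦ ζ^u` for a unit `u`
  have hemb : ∀ σ : K →+* ℂ, ∃ u : (ZMod N)ˣ, σ ζK = ζ ^ (u : ZMod N).val := by
    intro σ
    have hprimσ : IsPrimitiveRoot (σ ζK) N := hζK.map_of_injective σ.injective
    obtain ⟨i, hiN, hi⟩ := hζ.eq_pow_of_pow_eq_one hprimσ.pow_eq_one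
    have hcop : i.Coprime N := (hζ.pow_iff_coprime hN i).1 (hi ▸ hprimσ)
    refine ⟨ZMod.unitOfCoprime i hcop, ?_⟩
    rw [ZMod.coe_unitOfCoprime, ZMod.val_natCast, Nat.mod_eq_of_lt hiN, hi]
  -- an embedding `σ_v : ζ_N ↦ ζ^v` for every unit `v`
  have hembv : ∀ v : (ZMod N)ˣ, ∃ σ : K →+* ℂ, σ ζK = ζ ^ (v : ZMod N).val := by
    intro v
    have hyv : aeval (ζ ^ (v : ZMod N).val) (minpoly ℚ pb.gen) = 0 := by
      rw [hminpoly, hcyc_aeval]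
      exact ((hζ.pow_of_coprime _ (ZMod.val_coe_unit_coprime v)).isRoot_cyclotomic hN).eq_zero
    refine ⟨(pb.lift (ζ ^ (v : ZMod N).val) hyv).toRingHom, ?_⟩
    show pb.lift (ζ ^ (v : ZMod N).val) hyv ζK = _
    rw [← hpbgen]
    exact pb.lift_gen _ hyv
  -- (E) the GGK orientation of the action is the type table: `deg_A σ_u = deg u`
  set Λ := A.orientation hS' with hΛdef
  have hdegσ : ∀ (σ : K →+* ℂ) (u : (ZMod N)ˣ), σ ζK = ζ ^ (u : ZMod N).val → Λ.deg σ = deg u := by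
    intro σ u hσu
    have hline : ω u ∈ ⨅ e, Module.End.eigenspace ((A.ι e).baseChange ℂ) (σ e) := by
      rw [Submodule.mem_iInf]
      intro e
      rw [Module.End.mem_eigenspace_iff]
      obtain ⟨p, hp⟩ := pb.exists_eq_aeval' e
      rw [hp, hpbgen, hAι, hη_aeval, baseChange_aeval, Module.End.aeval_apply_of_hasEigenvector (hev u),
        hσ_aeval, hσu]
    have hmem : ω u ∈ H.piece (Λ.deg σ) (n - Λ.deg σ) :=
      A.iInf_eigenspace_le_piece hS' (A.eigenPiece_orientation_deg_ne_bot hS' σ) hline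
    have h1 : Λ.deg σ ≤ deg u := by
      by_contra hlt
      rw [not_le] at hlt
      exact hnF u (H.antitone_F (show deg u + 1 ≤ Λ.deg σ by omega) (H.piece_le_F _ _ hmem))
    have h2 : deg u ≤ Λ.deg σ := by
      by_contra hlt
      rw [not_le] at hlt
      have ha : ω u ∈ H.F (Λ.deg σ + 1) := H.antitone_F (show Λ.deg σ + 1 ≤ deg u by omega) (hF u)
      have hb : ω u ∈ complexConj (H.F (n - Λ.deg σ)) := H.piece_le_complexConj_F _ _ hmem
      have hc : ω u ∈ H.F (Λ.deg σ + 1) ⊓ complexConj (H.F (n - Λ.deg σ)) := ⟨ha, hb⟩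
      rw [(H.isCompl_F_complexConj (Λ.deg σ + 1) (n - Λ.deg σ) (by ring)).inf_eq_bot, Submodule.mem_bot] at hc
      exact hω0 u hc
    exact le_antisymm h1 h2
  -- (F) separation ⇒ the orientation is PRIMITIVE (`Aut(ℂ)`-form)
  have hprim : ∀ s t : K →+* ℂ,
      (∀ τ : ℂ ≃+* ℂ, Λ.deg ((τ : ℂ →+* ℂ).comp s) = Λ.deg ((τ : ℂ →+* ℂ).comp t)) → s = t := by
    intro s t hst
    obtain ⟨us, hus⟩ := hemb s
    obtain ⟨ut, hut⟩ := hemb t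
    have key : ∀ v : (ZMod N)ˣ, deg (us⁻¹ * ut * v) = deg v := by
      intro v
      obtain ⟨σv, hσv⟩ := hembv v
      obtain ⟨τ, hτ⟩ := ZarhinLie.exists_ringEquiv_complex_comp_eq s σv
      -- `τ ζ = ζ^w`
      have hτprim : IsPrimitiveRoot (τ ζ) N := hζ.map_of_injective τ.injective
      obtain ⟨j, hjN, hj⟩ := hζ.eq_pow_of_pow_eq_one hτprim.pow_eq_one
      have hcop : j.Coprime N := (hζ.pow_iff_coprime hN j).1 (hj ▸ hτprim)
      set w : (ZMod N)ˣ := ZMod.unitOfCoprime j hcop with hwdef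
      have hwval : (w : ZMod N).val = j := by
        rw [hwdef, ZMod.coe_unitOfCoprime, ZMod.val_natCast, Nat.mod_eq_of_lt hjN]
      have hτs : ((τ : ℂ →+* ℂ).comp s) ζK = ζ ^ ((w * us : (ZMod N)ˣ) : ZMod N).val := by
        rw [RingHom.comp_apply, RingHom.coe_coe, hus, map_pow, ← hj, pow_val_mul hζ, hwval]
      have hτt : ((τ : ℂ →+* ℂ).comp t) ζK = ζ ^ ((w * ut : (ZMod N)ˣ) : ZMod N).val := by
        rw [RingHom.comp_apply, RingHom.coe_coe, hut, map_pow, ← hj, pow_val_mul hζ, hwval]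
      -- `τ ∘ s = σ_v`, so `w us = v`
      have hwus : w * us = v := by
        apply hμ
        show ζ ^ ((w * us : (ZMod N)ˣ) : ZMod N).val = ζ ^ (v : ZMod N).val
        rw [← hτs, ← hσv, RingHom.comp_apply, RingHom.coe_coe, hτ]
      have h1 := hdegσ _ _ hτs
      have h2 := hdegσ _ _ hτt
      rw [hst τ] at h1
      rw [← hwus, show us⁻¹ * ut * (w * us) = w * ut by
        rw [mul_comm w us, ← mul_assoc, mul_assoc us⁻¹, mul_comm ut us, ← mul_assoc, inv_mul_cancel, one_mul,
          mul_comm], ← h2, h1]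
    have hw1 : us⁻¹ * ut = 1 := hsep _ key
    have hust : us = ut := by
      rw [← mul_one us, ← hw1, mul_inv_cancel_left]
    -- `s ζ_N = t ζ_N` ⇒ `s = t`
    have hgen : s.toRatAlgHom pb.gen = t.toRatAlgHom pb.gen := by
      rw [hpbgen]
      show s ζK = t ζK
      rw [hus, hut, hust]
    have := pb.algHom_ext hgen
    exact RingHom.ext fun x ↦ by simpa using congrArg (fun φ : K →ₐ[ℚ] ℂ ↦ φ x) this
  -- (G) primitive ⇒ `H` irreducible ⇒ `End_Hdg(H) = η(K) = ℚ[α]`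
  have hirrL : (ofOrientation Λ).IsIrreducible := isIrreducible_ofOrientation_of_primitive Λ hprim
  obtain ⟨f, hfbij, -⟩ := A.exists_hom_ofOrientation_bijective hS'
  have hirr : H.IsIrreducible := IsIrreducible.of_bijective hirrL f hfbij
  have hrange : A.ι.range = H.endAlg := A.range_ι_eq_endAlg hirr hS'
  have hg : (g : Module.End ℚ V) ∈ A.ι.range := by rw [hrange]; exact g.2
  obtain ⟨e, he⟩ : ∃ e, A.ι e = (g : Module.End ℚ V) := (AlgHom.mem_range _).1 hg
  obtain ⟨p, hp⟩ := pb.exists_eq_aeval' e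
  rw [← he, hp, hpbgen, hAι, hη_aeval, aeval_eq_sum_range]
  refine Submodule.sum_mem _ fun i _ ↦ Submodule.smul_mem _ _ ?_
  rw [hpowmod i]
  exact Submodule.subset_span ⟨⟨i % N, Nat.mod_lt i hN⟩, rfl⟩


end LevelOne

end Summit.HodgeConjecture.HodgeConjecture.Theorems.SeparatedCyclotomicSelfMapSquareHodge

end
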